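import Summits.QuantumFields.BalabanUV.Beta.EriceRemainderEnclosureHistoryAutonomyComparisonAgeComposition

/-!
# EriceRemainderEnclosureHistoryAutonomyComparisonAgeCompositionInduction — (E71b) ROUTE (N), THE END OF THE FIRST-ORDER INDUCTION OVER AGES: for a profile of
# `n` ages with lone kernels `K^{(1)}, …, K^{(n)}` (young to old) and aggregate kernels `K^{(≥i)}`, if at EVERY age `i` the surplus of the OLDER ages is a
# supersolution of the lone kernel of age `i` on non-increasing inputs (KEY_i) and the older reads of the age-`i` drops stay non-negative and non-increasing
# (MONO_i), then the first-order comparison surplus of the WHOLE profile is non-negative for every non-increasing excess — (E71a)'s two-kernel composition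
# iterated from the oldest age down, the empty profile as base; plus the HARNACK form of KEY

Cell `pub-balaban`, β-function sub-cell, BINDER row D4 «RemainderConst leaves for Bałaban's split» (`HOME/BINDER-OWNERS.md`; owner lineage `b2b-balaban-beta-an4`;
this file by co-owner #2 lineage `b2b-balaban-beta-d4-p2`, generation 62), β-FLOW TEAM duty (1), FREEZE (0) honoured (def-free; (E71a)'s `nonneg_of_age_composition_antitone`,
`sol_unique` BY NAME; nothing restated).

HONEST FRAMING (page 1, verbatim and binding).  *"Discharging BetaPertH makes Bałaban's UV stability UNCONDITIONAL — a real constructive-QFT result; it is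
NOT the continuum limit and NOT the Clay problem."*  THIS FILE DISCHARGES NOTHING OF THE KIND.  Elementary linear algebra about ABSTRACT real sequences and
triangular systems — hypotheses of a census, not facts; the form, signs, ages and moments of Bałaban's (1.22) limit functional are NOT PRINTED ([I] p. 298;
GAPS G-t4-U2-1∕-2) and NOT asserted.  Row D4 class UNCHANGED (critical-path width 0; instance 0∕1; D4 DISCHARGE NO DATE).  HONEST DEPENDENCY: continuum YM on
T⁴ ⇐ BetaPertH ∧ nine spine estimates (0/9 proved); BetaPertH ⇐ (D1) ∧ (D4) ∧ CAP+tail; G-an2-4 gates asym, D1 and NE2/3/4.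

THE POINT (census sense (α); the COMPARISON column, conjecture (E58′), route (N) of `HOME/b2b-balaban-beta-d4-p2/g62/e71/README.md`).  (E71a) is the
induction STEP «positivity for the older ages `O` ⟹ positivity for `O ∪ {y}`» of the first-order comparison system along a base orbit, modulo the two
level hypotheses KEY (the old surplus is a supersolution of the young kernel) and MONO (old reads of young drops are again admissible inputs).  This file
ITERATES it: ages indexed `1 … n` young to old, `K^{(≥i)} = K^{(i)} + K^{(≥i+1)}`, `K^{(≥n+1)} = 0`; the solution operators of the aggregates are displayed as
data `SA i` (zero-tailed solutions of `v = w − R^{(≥i)} v`), the lone ones as `SL i`; **`nonneg_of_key_mono_all_ages`**: KEY_i ∧ MONO_i at every age ⟹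
`SA i w ≥ 0` for every `i` and every non-negative non-increasing zero-tailed `w` (downward induction on `i`, base `SA (n+1) = id`); **`nonneg_of_key_mono`**:
the surplus of the whole profile.  So ROUTE (N) reads: THE FIRST-ORDER (E58′) FOR A FINITE PROFILE ⟸ KEY_i ∧ MONO_i AT EVERY AGE `i` — `n` inequalities, each
between ONE age and the aggregate of the OLDER ones along the common base flow (the lone row masses `Σ_l K^{(i)}_m(l) ≤ x_{k_i}(z_m)·(damping) < 1` never
enter except through KEY).  §1 also records the HARNACK FORM of KEY (`read_le_of_harnack`): if the old surplus grows over the window of age `i` by at most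
the factor `M_m` (`v_{m+1+l} ≤ M_m·v_m` wherever `K^{(i)}_m(l) ≠ 0`) and `M_m·Σ_l K^{(i)}_m(l) ≤ 1`, then KEY_i holds at the pin `m` — the numerics of record
(`g62/numerics/t9.py`, `t12.py`) give `x̃_i(z_m)·v_{m+k_i}∕v_m ≤ 0.55` over all flows tested, the supremum at the TRIVIAL older system, the Harnack load
`x̃·Σ_k d_k θ_k ∕ ((1−x̃)v) ≤ 0.06` (the rise of the old surplus over the young window costs ≤ 6 % of the margin), and local growth exponents
`log(v_{m+1}∕v_m)∕log(h_m∕h_{m+1}) ≤ 1.03` (the old surplus grows at most like `h^{-1.03}` — `t13.py`).  NOT CLAIMED: KEY_i or MONO_i for the flow; (E58′);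
anything nonlinear; anything printed.

WHAT IS PROVED ([folklore]; 0 `def`, 0 sorry).  §1 `aggregate_read_succ`, `aggregate_sol_top`, **`read_le_of_harnack`** (the Harnack form of KEY).  §2
**`nonneg_of_key_mono_all_ages`**, **`nonneg_of_key_mono`**.
-/
noncomputable section
open Finset

namespace Summit.QuantumFields.BalabanUV.Beta.EriceRemainderEnclosureHistoryAutonomyComparisonAgeCompositionInduction

open Summit.QuantumFields.BalabanUV.Beta.EriceRemainderEnclosureHistoryAutonomyComparisonAgeComposition

variable {N n : ℕ} {KL KA : ℕ → ℕ → ℕ → ℝ} {RL RA SL SA : ℕ → (ℕ → ℝ) → ℕ → ℝ}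

/-! ## §1 Aggregates, the empty profile, the Harnack form of KEY -/

/-- The aggregate read of the ages `≥ i` splits as the lone read of age `i` plus the aggregate read of the ages `≥ i+1` (kernel additivity). [folklore] -/
theorem aggregate_read_succ (hRL : ∀ i v m, RL i v m = ∑ l ∈ range N, KL i m l * v (m + 1 + l))
    (hRA : ∀ i v m, RA i v m = ∑ l ∈ range N, KA i m l * v (m + 1 + l))
    (hKA : ∀ i m l, KA i m l = KL i m l + KA (i + 1) m l) (i : ℕ) (v : ℕ → ℝ) (m : ℕ) :
    RA i v m = RA (i + 1) v m + RL i v m := by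
  rw [hRA, hRA, hRL, ← sum_add_distrib]
  exact sum_congr rfl fun l _ => by rw [hKA]; ring

/-- Beyond the oldest age the aggregate read vanishes and the solution operator is the identity. [folklore] -/
theorem aggregate_sol_top (hRA : ∀ i v m, RA i v m = ∑ l ∈ range N, KA i m l * v (m + 1 + l))
    (hKAtop : ∀ m l, KA (n + 1) m l = 0)
    (hSA : ∀ i (w : ℕ → ℝ), (∀ m, N < m → w m = 0) → (∀ m, N < m → SA i w m = 0) ∧ ∀ m, SA i w m = w m - RA i (SA i w) m)
    {w : ℕ → ℝ} (hw : ∀ m, N < m → w m = 0) (m : ℕ) : SA (n + 1) w m = w m := by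
  rw [(hSA (n + 1) w hw).2 m, hRA]
  simp [hKAtop]


/-- **THE HARNACK FORM OF KEY.**  A non-negative kernel row `K m ·`, a sequence `v` with `v m ≥ 0` whose deeper values on the support of the row grow by at
most the factor `M`: `K m l · v (m+1+l) ≤ K m l · (M · v m)` for every lag, and the row mass bound `M · Σ_l K m l ≤ 1`.  Then the read is below the pin value:
`R v m ≤ v m`.  (KEY_i at the pin `m` from a growth bound of the old surplus over the window of age `i` against the damped load of age `i`.) [folklore] -/
theorem read_le_of_harnack {K : ℕ → ℕ → ℝ} {R : (ℕ → ℝ) → ℕ → ℝ} (hR : ∀ v m, R v m = ∑ l ∈ range N, K m l * v (m + 1 + l))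
    {v : ℕ → ℝ} {m : ℕ} {M : ℝ} (hv : 0 ≤ v m) (hH : ∀ l ∈ range N, K m l * v (m + 1 + l) ≤ K m l * (M * v m))
    (hrow : M * ∑ l ∈ range N, K m l ≤ 1) : R v m ≤ v m := by
  rw [hR]
  calc ∑ l ∈ range N, K m l * v (m + 1 + l) ≤ ∑ l ∈ range N, K m l * (M * v m) := sum_le_sum hH
    _ = (M * ∑ l ∈ range N, K m l) * v m := by rw [← sum_mul]; ring
    _ ≤ 1 * v m := mul_le_mul_of_nonneg_right hrow hv
    _ = v m := one_mul _

/-! ## §2 The induction over ages -/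

/-- **ROUTE (N), THE END THEOREM OF THE FIRST-ORDER INDUCTION OVER AGES.**  Ages `1, …, n` (young to old) with NON-NEGATIVE lone kernels `KL i` on the horizon
`N`, aggregate kernels `KA i = KL i + KA (i+1)` (`KA (n+1) = 0`: the ages `≥ i`), their read operators `RL i`, `RA i` and zero-tailed triangular solution operators
`SL i`, `SA i`.  Suppose at EVERY age `i ≤ n`, for every non-negative non-increasing zero-tailed input `w`: (KEY_i) the surplus `v = SA (i+1) w` of the OLDER
ages is a supersolution of the lone kernel of age `i`, `RL i v ≤ v`; (MONO_i) the older reads of the age-`i` drops of the age-`i` solution, `RA (i+1) (RL i (SL i v))`,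
are non-negative and non-increasing.  Then for every `i ≤ n+1` the surplus `SA i w` of the ages `≥ i` is NON-NEGATIVE for every such input — in particular
(`i = 1`) the first-order comparison surplus of the whole profile.  Downward induction on `i` by (E71a) `nonneg_of_age_composition_antitone`; the base
`i = n+1` is the empty profile (`SA (n+1) w = w`). [folklore] -/
theorem nonneg_of_key_mono_all_ages
    (hKL : ∀ i m l, 0 ≤ KL i m l)
    (hRL : ∀ i v m, RL i v m = ∑ l ∈ range N, KL i m l * v (m + 1 + l))
    (hRA : ∀ i v m, RA i v m = ∑ l ∈ range N, KA i m l * v (m + 1 + l))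
    (hKA : ∀ i m l, KA i m l = KL i m l + KA (i + 1) m l) (hKAtop : ∀ m l, KA (n + 1) m l = 0)
    (hSL : ∀ i (w : ℕ → ℝ), (∀ m, N < m → w m = 0) → (∀ m, N < m → SL i w m = 0) ∧ ∀ m, SL i w m = w m - RL i (SL i w) m)
    (hSA : ∀ i (w : ℕ → ℝ), (∀ m, N < m → w m = 0) → (∀ m, N < m → SA i w m = 0) ∧ ∀ m, SA i w m = w m - RA i (SA i w) m)
    (hKEY : ∀ i, 1 ≤ i → i ≤ n → ∀ w : ℕ → ℝ, (∀ m, 0 ≤ w m) → (∀ m, w (m + 1) ≤ w m) → (∀ m, N < m → w m = 0) →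
      ∀ m, RL i (SA (i + 1) w) m ≤ SA (i + 1) w m)
    (hMONO : ∀ i, 1 ≤ i → i ≤ n → ∀ w : ℕ → ℝ, (∀ m, 0 ≤ w m) → (∀ m, w (m + 1) ≤ w m) → (∀ m, N < m → w m = 0) →
      (∀ m, 0 ≤ RA (i + 1) (RL i (SL i (SA (i + 1) w))) m) ∧
      (∀ m, RA (i + 1) (RL i (SL i (SA (i + 1) w))) (m + 1) ≤ RA (i + 1) (RL i (SL i (SA (i + 1) w))) m)) :
    ∀ i, 1 ≤ i → i ≤ n + 1 → ∀ w : ℕ → ℝ, (∀ m, 0 ≤ w m) → (∀ m, w (m + 1) ≤ w m) → (∀ m, N < m → w m = 0) →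
      ∀ m, 0 ≤ SA i w m := by
  suffices h : ∀ d i, i + d = n + 1 → 1 ≤ i → ∀ w : ℕ → ℝ, (∀ m, 0 ≤ w m) → (∀ m, w (m + 1) ≤ w m) → (∀ m, N < m → w m = 0) →
      ∀ m, 0 ≤ SA i w m from fun i hi hin => h (n + 1 - i) i (by omega) hi
  intro d
  induction d with
  | zero =>
    intro i hi _ w hw0 _ hwt m
    have : i = n + 1 := by omega
    subst this
    rw [aggregate_sol_top hRA hKAtop hSA hwt m]; exact hw0 m
  | succ d ih =>
    intro i hi hi1 w hw0 hwa hwt m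
    have hin : i ≤ n := by omega
    have hP := ih (i + 1) (by omega) (by omega)
    -- the full system at level `i` is the two-kernel system (old = ages ≥ i+1, young = age i)
    have hεrec : ∀ m, SA i w m = w m - RA (i + 1) (SA i w) m - RL i (SA i w) m := fun m => by
      rw [(hSA i w hwt).2 m, aggregate_read_succ hRL hRA hKA]; ring
    exact (nonneg_of_age_composition_antitone (RO := RA (i + 1)) (Ry := RL i) (SO := SA (i + 1)) (Sy := SL i)
      (hRA (i + 1)) (hRL i) (hKL i) (hSA (i + 1)) (hSL i)
      (fun u hu0 hua hut => ⟨hP u hu0 hua hut, hKEY i hi1 hin u hu0 hua hut, hMONO i hi1 hin u hu0 hua hut⟩)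
      hw0 hwa hwt (hSA i w hwt).1 hεrec m).1

/-- **FIRST-ORDER COMPARISON FOR THE WHOLE PROFILE** (`i = 1` in `nonneg_of_key_mono_all_ages`): under KEY_i and MONO_i at every age, the solution `ε` of
the full triangular system `ε = e − RA 1 ε` (all `n` ages) with a non-negative non-increasing zero-tailed excess `e` is non-negative at every depth.
[folklore] -/
theorem nonneg_of_key_mono
    (hKL : ∀ i m l, 0 ≤ KL i m l)
    (hRL : ∀ i v m, RL i v m = ∑ l ∈ range N, KL i m l * v (m + 1 + l))
    (hRA : ∀ i v m, RA i v m = ∑ l ∈ range N, KA i m l * v (m + 1 + l))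
    (hKA : ∀ i m l, KA i m l = KL i m l + KA (i + 1) m l) (hKAtop : ∀ m l, KA (n + 1) m l = 0)
    (hSL : ∀ i (w : ℕ → ℝ), (∀ m, N < m → w m = 0) → (∀ m, N < m → SL i w m = 0) ∧ ∀ m, SL i w m = w m - RL i (SL i w) m)
    (hSA : ∀ i (w : ℕ → ℝ), (∀ m, N < m → w m = 0) → (∀ m, N < m → SA i w m = 0) ∧ ∀ m, SA i w m = w m - RA i (SA i w) m)
    (hKEY : ∀ i, 1 ≤ i → i ≤ n → ∀ w : ℕ → ℝ, (∀ m, 0 ≤ w m) → (∀ m, w (m + 1) ≤ w m) → (∀ m, N < m → w m = 0) →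
      ∀ m, RL i (SA (i + 1) w) m ≤ SA (i + 1) w m)
    (hMONO : ∀ i, 1 ≤ i → i ≤ n → ∀ w : ℕ → ℝ, (∀ m, 0 ≤ w m) → (∀ m, w (m + 1) ≤ w m) → (∀ m, N < m → w m = 0) →
      (∀ m, 0 ≤ RA (i + 1) (RL i (SL i (SA (i + 1) w))) m) ∧
      (∀ m, RA (i + 1) (RL i (SL i (SA (i + 1) w))) (m + 1) ≤ RA (i + 1) (RL i (SL i (SA (i + 1) w))) m))
    {e ε : ℕ → ℝ} (he0 : ∀ m, 0 ≤ e m) (hea : ∀ m, e (m + 1) ≤ e m) (het : ∀ m, N < m → e m = 0)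
    (hεt : ∀ m, N < m → ε m = 0) (hεrec : ∀ m, ε m = e m - RA 1 ε m) : ∀ m, 0 ≤ ε m := by
  have hpos := nonneg_of_key_mono_all_ages hKL hRL hRA hKA hKAtop hSL hSA hKEY hMONO 1 le_rfl (by omega) e he0 hea het
  have heq : ∀ m, ε m = SA 1 e m := sol_unique (hRA 1) hεt hεrec (hSA 1 e het).1 (hSA 1 e het).2
  exact fun m => (heq m).symm ▸ hpos m

end Summit.QuantumFields.BalabanUV.Beta.EriceRemainderEnclosureHistoryAutonomyComparisonAgeCompositionInduction

end
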